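import Literature.Barriers.AnomalousDissipation.MeasureValuedWeakStrongProofs
import HarnessLib

/-!
# Brenier–De Lellis–Székelyhidi 2011, Cor. 1, uniform in time, and the absence of anomalous
dissipation on `[0,T]` for Leray–Hopf families next to a regular Euler solution

Sibling theorems file of the barrier `MeasureValuedWeakStrong.lean` and its proofs file
(D-0021 barrier audit of `BrenierDeLellisSzekelyhidi2011_cor1`, 2026-08-15); no definitions, no
named facts. The barrier block of `BrenierDeLellisSzekelyhidi2011_cor1` asserts that the printed
`L²((0,T) × ℝⁿ)` convergence of Leray solutions to the regular Euler solution `v` (condition (8):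
`∫₀ᵀ ‖∇v + ∇vᵀ‖_∞ < ∞`) *blocks anomalous dissipation on `[0,T]`*, quoting Bruè–De Lellis
(CMP 400 (2023), §1): "from this strong convergence, it is then elementary to infer that
[anomalous dissipation] cannot hold". This file makes that inference a checked theorem, in the
hypotheses of the named fact (any finite-dimensional real inner-product space `E` in place of
`ℝⁿ`):

* `leray_euler_eventually_forall_integral_norm_sub_sq_le` — the convergence is uniform in time:
  for every `ε > 0`, eventually in `k`, `∫ |u_k(t) - v(t)|² ≤ ε` for all `t ∈ (0,T]` (the
  slice-wise Grönwall bound `Literature.Analysis.FluidPDE.leray_euler_integral_norm_sub_sq_le`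
  of the proofs file, with the two limits `φ_m → δ₀`, `ν_k → 0` taken as there);
* `leray_euler_tendsto_integral_norm_sq` — the kinetic energy at the final time converges to the
  initial energy: `∫ |u_k(T)|² → ∫ |v₀|² = ∫ |v(T)|²` (energy conservation of `v` under (8),
  `Literature.Analysis.FluidPDE.euler_integral_inner_self_eq`);
* `leray_euler_tendsto_energyDefect` — the energy defect `E(v₀) - E(u_k(T)) → 0`;
* `leray_euler_tendsto_cumulativeDissipation` — **no anomalous dissipation on `[0,T]`**:
  `ν_k ∫₀ᵀ ‖∇u_k(t)‖₂² dt → 0`, the enstrophy being the canonical extended functional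
  `Literature.Analysis.FluidPDE.eWeakGradL2Sq` (infimum over weak gradients), which the
  Leray–Hopf energy inequality bounds by the energy defect.

Scope note recorded by the audit: the relative-energy argument is indifferent to replacing the
fixed datum of the Leray family by data `u_k(0) → v₀` *strongly* in `L²` (Bruè–De Lellis 2023,
Appendix, Lemma 7, for classical solutions; Brenier–De Lellis–Székelyhidi 2011, §3, Def. 1 with
Prop. 1 and Thm. 2, the admissibility inequality passing to the limit under norm convergence of
the data); the statements below keep the fixed datum of the named fact because the vendored
Grönwall lemma is stated for it.

## References

* Y. Brenier, C. De Lellis, L. Székelyhidi Jr., Comm. Math. Phys. 305 (2011) 351–361, §3,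
  Prop. 1, Thm. 2, Cor. 1 (arXiv:0912.1028). [BrenierDeLellisSzekelyhidi2011]
* E. Bruè, C. De Lellis, Comm. Math. Phys. 400 (2023), §1 and Appendix, Lemma 7
  (arXiv:2207.06301). [BrueDeLellis2023]
* C. Bardos, in *Partial Differential Equations in Fluid Mechanics*, LMS Lect. Note Ser. 452
  (2018), Thm. 1.3, (1.14b) ⇔ (1.14d) (uniform `L²` convergence ⇔ vanishing dissipation; Kato's
  criterion). [Bardos2018]
-/

noncomputable section

open MeasureTheory TopologicalSpace Set Function Filter ContinuousLinearMap InnerProductSpace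
  Literature.Analysis.FluidPDE Literature.Analysis
open scoped ENNReal NNReal Convolution RealInnerProductSpace Topology Laplacian

namespace Literature.Barriers.AnomalousDissipation

variable {E : Type*} [NormedAddCommGroup E] [InnerProductSpace ℝ E] [FiniteDimensional ℝ E]
  [MeasurableSpace E] [BorelSpace E] [CompleteSpace E]

variable {T : ℝ} {v₀ : E → E} {v : ℝ → E → E} {ν : ℕ → ℝ} {u : ℕ → ℝ → E → E}

/-! ### Auxiliary identities -/

omit [CompleteSpace E] in
/-- `∫ ‖w‖² = ‖w‖_{L²}²` (real form) for `w ∈ L²`. [folklore] -/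
private theorem integral_norm_sq_eq_sq (w : E → E) (hw : MemLp w 2 volume) :
    ∫ x, ‖w x‖ ^ 2 = (eLpNorm w 2 volume).toReal ^ 2 := by
  rw [← integral_inner_self_eq_sq_toReal_eLpNorm hw]
  exact integral_congr_ae (ae_of_all _ fun x => (real_inner_self_eq_norm_sq (w x)).symm)

/-- A jointly measurable weak-gradient witness with condition (8), from the existential
hypothesis of the named fact. [folklore] -/
private theorem exists_measurable_symGrad_witness (hv : IsWeakNSSolutionOn T 0 0 v₀ v)
    (hsymm : ∃ G : ℝ → E → E →L[ℝ] E,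
      (∀ᵐ t ∂(volume.restrict (Ioo 0 T)), HasWeakGradient (v t) (G t)) ∧
      ∫⁻ t in Ioo 0 T, eLpNorm (fun x => G t x + adjoint (G t x)) ∞ volume < ∞) :
    ∃ G : ℝ → E → E →L[ℝ] E,
      (∀ᵐ t ∂(volume.restrict (Ioo 0 T)), HasWeakGradient (v t) (G t)) ∧
      StronglyMeasurable (uncurry G) ∧
      ∫⁻ t in Ioo 0 T, eLpNorm (fun x => G t x + adjoint (G t x)) ∞ volume < ∞ := by
  obtain ⟨G₀, hG₀, hS₀⟩ := hsymm
  obtain ⟨G, hGm, hGG₀⟩ := exists_stronglyMeasurable_weakGradient hv.1 hG₀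
  have hG : ∀ᵐ t ∂(volume.restrict (Ioo 0 T)), HasWeakGradient (v t) (G t) := by
    filter_upwards [hG₀, hGG₀] with t h1 h2 using h1.congr_grad_ae h2
  have hSeq : ∀ᵐ t ∂(volume.restrict (Ioo 0 T)),
      eLpNorm (fun x => G t x + adjoint (G t x)) ∞ volume =
        eLpNorm (fun x => G₀ t x + adjoint (G₀ t x)) ∞ volume := by
    filter_upwards [hGG₀] with t ht
    refine eLpNorm_congr_ae ?_
    filter_upwards [ht] with x hx
    rw [hx]
  refine ⟨G, hG, hGm, ?_⟩
  rwa [lintegral_congr_ae hSeq]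

/-- Elementary bookkeeping for the `ε`-argument: if the three vanishing error terms are below
`θ` and `e^Λ (4N₀ + 3) θ ≤ ε`, the slice-wise Grönwall bound is below `ε`. [folklore] -/
private theorem slice_bound_aux {N₀ Λ a₀ aI aZ θ ε : ℝ} (hN : 0 ≤ N₀)
    (h0 : a₀ ≤ θ) (hI : aI ≤ θ) (hZ : aZ ≤ θ) (hε : Real.exp Λ * (4 * N₀ + 3) * θ ≤ ε) :
    (2 * N₀ * (a₀ + θ) + 2 * aI + aZ) * Real.exp Λ ≤ ε := by
  have hexp : 0 < Real.exp Λ := Real.exp_pos _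
  have h1 : 2 * N₀ * (a₀ + θ) + 2 * aI + aZ ≤ (4 * N₀ + 3) * θ := by nlinarith
  calc (2 * N₀ * (a₀ + θ) + 2 * aI + aZ) * Real.exp Λ
      ≤ (4 * N₀ + 3) * θ * Real.exp Λ := mul_le_mul_of_nonneg_right h1 hexp.le
    _ = Real.exp Λ * (4 * N₀ + 3) * θ := by ring
    _ ≤ ε := hε

/-! ### Uniform-in-time convergence -/

set_option maxHeartbeats 800000 in
/-- **Brenier–De Lellis–Székelyhidi 2011, Cor. 1, uniform in time.** Let `v ∈ C([0,T]; L²)` be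
a weak Euler solution with datum `v₀ ∈ L²_σ` and `∫₀ᵀ ‖∇v + ∇vᵀ‖_{L^∞} dt < ∞`, and let `u_k` be
Leray–Hopf solutions of Navier–Stokes with viscosities `ν_k → 0`, zero force and the same datum.
Then for every `ε > 0`, for all large `k` and **all** `t ∈ (0,T]`, `∫ |u_k(t) - v(t)|² ≤ ε`:
convergence in `L^∞(0,T; L²)`, the form actually produced by the relative-energy (Grönwall)
argument (the printed corollary states `L²((0,T) × ℝⁿ)`). Proof: the slice-wise bound
`leray_euler_integral_norm_sub_sq_le` with the mollification scale `φ_m` chosen first (the errors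
`‖v₀ - φ_m⋆v₀‖`, `∫₀ᵀ err_{φ_m}`, `sup_s ‖v(s) - φ_m⋆v(s)‖` below `θ`) and then `k` large (the
viscous error `2Tν_k‖v₀‖‖Δφ_m‖₁R` below `θ`).
[cite: BrenierDeLellisSzekelyhidi2011, §3.1 proof of Thm. 2 and Cor. 1] -/
theorem leray_euler_eventually_forall_integral_norm_sub_sq_le (hT : 0 < T)
    (hv₀ : MemLp v₀ 2 volume) (hv₀div : IsWeaklyDivFree v₀)
    (hEuler : IsWeakEulerSolutionOn T 0 v₀ v) (hc : ContinuousInLpOn (Icc 0 T) 2 v)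
    (hsymm : ∃ G : ℝ → E → E →L[ℝ] E,
      (∀ᵐ t ∂(volume.restrict (Ioo 0 T)), HasWeakGradient (v t) (G t)) ∧
      ∫⁻ t in Ioo 0 T, eLpNorm (fun x => G t x + adjoint (G t x)) ∞ volume < ∞)
    (hν : ∀ k, 0 < ν k) (hν₀ : Tendsto ν atTop (𝓝 0))
    (hLeray : ∀ k, IsGlobalLerayHopf (ν k) 0 v₀ (u k)) {ε : ℝ} (hε : 0 < ε) :
    ∀ᶠ k in atTop, ∀ t ∈ Ioc 0 T, ∫ x, ‖u k t x - v t x‖ ^ 2 ≤ ε := by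
  have hv : IsWeakNSSolutionOn T 0 0 v₀ v := hEuler
  obtain ⟨G, hG, hGm, hS⟩ := exists_measurable_symGrad_witness hv hsymm
  obtain ⟨R, hR⟩ := hc.exists_eLpNorm_le_of_Icc
  obtain ⟨φ, hφ, h'φ⟩ := FunctionSpaces.exists_contDiffBump_seq (E := E)
  -- scalar data
  set N₀ : ℝ := (eLpNorm v₀ 2 volume).toReal with hN₀
  set Λ : ℝ := (∫⁻ s in Ioo 0 T, eLpNorm (fun x => G s x + adjoint (G s x)) ∞ volume).toReal
    with hΛ
  have hN₀0 : 0 ≤ N₀ := ENNReal.toReal_nonneg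
  -- ### the vanishing errors
  -- `‖v₀ - φ_m ⋆ v₀‖ → 0`
  have hη₀ : Tendsto (fun m =>
      (eLpNorm (v₀ - (φ m).normed volume ⋆[lsmul ℝ ℝ, volume] v₀) 2 volume).toReal)
      atTop (𝓝 0) := by
    have h := FunctionSpaces.tendsto_eLpNorm_normed_convolution_sub_self
      (μ := (volume : Measure E)) hφ one_le_two ENNReal.ofNat_ne_top hv₀
    rw [← ENNReal.toReal_zero]
    refine ((ENNReal.tendsto_toReal ENNReal.zero_ne_top).comp h).congr fun m => ?_
    simp only [Function.comp_apply]
    rw [eLpNorm_sub_comm]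
  -- `∫₀ᵀ err_{φ_m} → 0`
  have hI := (ENNReal.tendsto_toReal ENNReal.zero_ne_top).comp
    (tendsto_lintegral_sliceErr hv hG hGm hS hR hφ h'φ (K := 2 * (N₀ + R)) (by positivity))
  rw [ENNReal.toReal_zero] at hI
  -- `sup_s ‖v(s) - φ_m ⋆ v(s)‖ → 0`
  have hsup : ∀ θ : ℝ, 0 < θ → ∀ᶠ m in atTop, ∀ s ∈ Icc 0 T,
      (eLpNorm (v s - (φ m).normed volume ⋆[lsmul ℝ ℝ, volume] v s) 2 volume).toReal ≤ θ :=
    fun θ hθ => eventually_forall_eLpNorm_sub_normed_convolution_le hc hφ hθ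
  -- the viscous term, `k → ∞` at fixed `m`
  have hZ : ∀ m, Tendsto (fun k => 2 * T * (ν k * N₀ *
      ((∫⁻ y, ‖(Δ ((φ m).normed volume)) y‖ₑ).toReal * R))) atTop (𝓝 0) := fun m => by
    have := ((hν₀.mul_const N₀).mul_const
      ((∫⁻ y, ‖(Δ ((φ m).normed volume)) y‖ₑ).toReal * R)).const_mul (2 * T)
    simpa using this
  -- ### the `ε`-argument
  have hC0 : 0 ≤ Real.exp Λ * (4 * N₀ + 3) := by positivity
  have hden : 0 < Real.exp Λ * (4 * N₀ + 3) + 1 := by positivity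
  set θ : ℝ := ε / (Real.exp Λ * (4 * N₀ + 3) + 1) with hθ
  have hθ0 : 0 < θ := div_pos hε hden
  have hθle : Real.exp Λ * (4 * N₀ + 3) * θ ≤ ε := by
    rw [hθ, mul_div_assoc', div_le_iff₀ hden]
    nlinarith [hε.le]
  -- choose the mollification scale
  obtain ⟨m, hm1, hm2, hm3⟩ := (((tendsto_order.1 hη₀).2 θ hθ0).and
    ((((tendsto_order.1 hI).2 θ hθ0)).and (hsup θ hθ0))).exists
  -- then the viscosity
  filter_upwards [(tendsto_order.1 (hZ m)).2 θ hθ0] with k hk t ht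
  have hB := leray_euler_integral_norm_sub_sq_le hT (hν k).le (hLeray k T hT) hv hc hv₀ hv₀div
    hG hGm hS hR (φ m) hm3 ht
  exact hB.trans (slice_bound_aux hN₀0 hm1.le hm2.le hk.le hθle)

/-- The relative energy at a fixed time `t ∈ (0,T]` tends to zero: `∫ |u_k(t) - v(t)|² → 0`.
[cite: BrenierDeLellisSzekelyhidi2011, Cor. 1] -/
theorem leray_euler_tendsto_integral_norm_sub_sq (hT : 0 < T)
    (hv₀ : MemLp v₀ 2 volume) (hv₀div : IsWeaklyDivFree v₀)
    (hEuler : IsWeakEulerSolutionOn T 0 v₀ v) (hc : ContinuousInLpOn (Icc 0 T) 2 v)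
    (hsymm : ∃ G : ℝ → E → E →L[ℝ] E,
      (∀ᵐ t ∂(volume.restrict (Ioo 0 T)), HasWeakGradient (v t) (G t)) ∧
      ∫⁻ t in Ioo 0 T, eLpNorm (fun x => G t x + adjoint (G t x)) ∞ volume < ∞)
    (hν : ∀ k, 0 < ν k) (hν₀ : Tendsto ν atTop (𝓝 0))
    (hLeray : ∀ k, IsGlobalLerayHopf (ν k) 0 v₀ (u k)) {t : ℝ} (ht : t ∈ Ioc 0 T) :
    Tendsto (fun k => ∫ x, ‖u k t x - v t x‖ ^ 2) atTop (𝓝 0) := by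
  refine tendsto_order.2 ⟨fun a ha => Eventually.of_forall fun k =>
    ha.trans_le (integral_nonneg fun x => by positivity), fun a ha => ?_⟩
  filter_upwards [leray_euler_eventually_forall_integral_norm_sub_sq_le hT hv₀ hv₀div hEuler hc
    hsymm hν hν₀ hLeray (half_pos ha)] with k hk
  exact (hk t ht).trans_lt (half_lt_self ha)

/-! ### The energy at the final time and the energy defect -/

/-- **The kinetic energy at time `T` converges to the initial energy.** In the situation of
`BrenierDeLellisSzekelyhidi2011_cor1`, `∫ |u_k(T)|² → ∫ |v₀|²`: `u_k(T) → v(T)` in `L²`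
(`leray_euler_tendsto_integral_norm_sub_sq`), hence `‖u_k(T)‖_{L²} → ‖v(T)‖_{L²}`, and
`‖v(T)‖_{L²} = ‖v₀‖_{L²}` by conservation of energy for weak Euler solutions with (8)
(`Literature.Analysis.FluidPDE.euler_integral_inner_self_eq`, Brenier–De Lellis–Székelyhidi 2011, proof of
Thm. 2: "`∫ |v|²(x,t) dx` is constant"). [cite: BrenierDeLellisSzekelyhidi2011, §3.1 proof of Thm. 2 and Cor. 1] -/
theorem leray_euler_tendsto_integral_norm_sq (hT : 0 < T)
    (hv₀ : MemLp v₀ 2 volume) (hv₀div : IsWeaklyDivFree v₀)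
    (hEuler : IsWeakEulerSolutionOn T 0 v₀ v) (hc : ContinuousInLpOn (Icc 0 T) 2 v)
    (hsymm : ∃ G : ℝ → E → E →L[ℝ] E,
      (∀ᵐ t ∂(volume.restrict (Ioo 0 T)), HasWeakGradient (v t) (G t)) ∧
      ∫⁻ t in Ioo 0 T, eLpNorm (fun x => G t x + adjoint (G t x)) ∞ volume < ∞)
    (hν : ∀ k, 0 < ν k) (hν₀ : Tendsto ν atTop (𝓝 0))
    (hLeray : ∀ k, IsGlobalLerayHopf (ν k) 0 v₀ (u k)) :
    Tendsto (fun k => ∫ x, ‖u k T x‖ ^ 2) atTop (𝓝 (∫ x, ‖v₀ x‖ ^ 2)) := by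
  have hv : IsWeakNSSolutionOn T 0 0 v₀ v := hEuler
  have hTI : T ∈ Icc 0 T := ⟨hT.le, le_rfl⟩
  have hvT : MemLp (v T) 2 volume := hc.1 T hTI
  have huT : ∀ k, MemLp (u k T) 2 volume := fun k => (hLeray k T hT).memLp T hTI
  -- energy conservation of `v`
  obtain ⟨G, hG, hGm, hS⟩ := exists_measurable_symGrad_witness hv hsymm
  have hcons : ∫ x, ‖v T x‖ ^ 2 = ∫ x, ‖v₀ x‖ ^ 2 := by
    have h := euler_integral_inner_self_eq hT hv hc hv₀ hv₀div hG hGm hS (t := T) ⟨hT, le_rfl⟩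
    have h1 : ∫ x, ‖v T x‖ ^ 2 = ∫ x, ⟪v T x, v T x⟫ :=
      integral_congr_ae (ae_of_all _ fun x => (real_inner_self_eq_norm_sq (v T x)).symm)
    have h2 : ∫ x, ‖v₀ x‖ ^ 2 = ∫ x, ⟪v₀ x, v₀ x⟫ :=
      integral_congr_ae (ae_of_all _ fun x => (real_inner_self_eq_norm_sq (v₀ x)).symm)
    rw [h1, h2, h]
  -- `L²` packaging
  set B : Lp E 2 (volume : Measure E) := hvT.toLp (v T) with hB
  set A : ℕ → Lp E 2 (volume : Measure E) := fun k => (huT k).toLp (u k T) with hA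
  have hdist : ∀ k, ‖A k - B‖ = (eLpNorm (u k T - v T) 2 volume).toReal := fun k => by
    rw [hA, hB, ← MemLp.toLp_sub, Lp.norm_toLp]
  have hsq : ∀ k, ‖A k - B‖ ^ 2 = ∫ x, ‖u k T x - v T x‖ ^ 2 := fun k => by
    rw [hdist, ← integral_norm_sq_eq_sq _ ((huT k).sub hvT)]
    rfl
  -- `‖A k - B‖ → 0`
  have he := leray_euler_tendsto_integral_norm_sub_sq hT hv₀ hv₀div hEuler hc hsymm hν hν₀ hLeray
    (t := T) ⟨hT, le_rfl⟩
  have hnorm : Tendsto (fun k => ‖A k - B‖) atTop (𝓝 0) := by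
    have hsqrt := (Real.continuous_sqrt.tendsto 0).comp he
    rw [Real.sqrt_zero] at hsqrt
    refine hsqrt.congr fun k => ?_
    simp only [Function.comp_apply]
    rw [← hsq k, Real.sqrt_sq (norm_nonneg _)]
  have hAB : Tendsto A atTop (𝓝 B) := tendsto_iff_norm_sub_tendsto_zero.2 hnorm
  have hnAB : Tendsto (fun k => ‖A k‖ ^ 2) atTop (𝓝 (‖B‖ ^ 2)) := (hAB.norm).pow 2
  -- unpack the norms
  have hAk : ∀ k, ‖A k‖ ^ 2 = ∫ x, ‖u k T x‖ ^ 2 := fun k => by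
    rw [hA, Lp.norm_toLp, ← integral_norm_sq_eq_sq _ (huT k)]
  have hBn : ‖B‖ ^ 2 = ∫ x, ‖v₀ x‖ ^ 2 := by
    rw [hB, Lp.norm_toLp, ← integral_norm_sq_eq_sq _ hvT, hcons]
  rw [hBn] at hnAB
  exact hnAB.congr fun k => hAk k

/-- **The energy defect vanishes.** In the situation of `BrenierDeLellisSzekelyhidi2011_cor1`,
`E(v₀) - E(u_k(T)) → 0` with `E = Literature.Analysis.FluidPDE.VectorCalculus.kineticEnergy = ½∫|·|²`. Since the
Leray–Hopf energy inequality reads `E(u_k(T)) + ν_k∫₀ᵀ‖∇u_k‖₂² ≤ E(v₀)` (zero force), this is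
the statement that bounds the cumulative dissipation; see
`leray_euler_tendsto_cumulativeDissipation`. [cite: BrueDeLellis2023, §1 ("from this strong convergence, it is then elementary to infer")] -/
theorem leray_euler_tendsto_energyDefect (hT : 0 < T)
    (hv₀ : MemLp v₀ 2 volume) (hv₀div : IsWeaklyDivFree v₀)
    (hEuler : IsWeakEulerSolutionOn T 0 v₀ v) (hc : ContinuousInLpOn (Icc 0 T) 2 v)
    (hsymm : ∃ G : ℝ → E → E →L[ℝ] E,
      (∀ᵐ t ∂(volume.restrict (Ioo 0 T)), HasWeakGradient (v t) (G t)) ∧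
      ∫⁻ t in Ioo 0 T, eLpNorm (fun x => G t x + adjoint (G t x)) ∞ volume < ∞)
    (hν : ∀ k, 0 < ν k) (hν₀ : Tendsto ν atTop (𝓝 0))
    (hLeray : ∀ k, IsGlobalLerayHopf (ν k) 0 v₀ (u k)) :
    Tendsto (fun k => VectorCalculus.kineticEnergy v₀ - VectorCalculus.kineticEnergy (u k T))
      atTop (𝓝 0) := by
  have h := ((leray_euler_tendsto_integral_norm_sq hT hv₀ hv₀div hEuler hc hsymm hν hν₀
    hLeray).const_mul (2⁻¹ : ℝ)).const_sub (2⁻¹ * ∫ x, ‖v₀ x‖ ^ 2)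
  rw [sub_self] at h
  simpa only [VectorCalculus.kineticEnergy] using h

/-! ### No anomalous dissipation on `[0,T]` -/

/-- **No anomalous dissipation before the loss of regularity (8)** (Brenier–De Lellis–Székelyhidi
2011, Cor. 1, with the inference of Bruè–De Lellis 2023, §1). In the situation of
`BrenierDeLellisSzekelyhidi2011_cor1` — `v ∈ C([0,T]; L²)` a weak Euler solution from
`v₀ ∈ L²_σ` with `∫₀ᵀ‖∇v + ∇vᵀ‖_∞ < ∞`, `u_k` global Leray–Hopf solutions with viscosities
`ν_k ↓ 0`, zero force, datum `v₀` — the cumulative energy dissipation on `[0,T]` vanishes in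
the limit: `ν_k ∫₀ᵀ ‖∇u_k(t)‖₂² dt → 0`, where `‖∇u_k(t)‖₂² = eWeakGradL2Sq (u_k t) ∈ [0,∞]` is
the canonical extended enstrophy (infimum over weak gradients; `.toReal` of the time integral,
which is finite for Leray–Hopf solutions). Proof: the Leray–Hopf energy inequality from `s = 0`
with its weak-gradient witness `G_k` gives
`0 ≤ ν_k∫₀ᵀ eWeakGradL2Sq(u_k) ≤ ν_k∫₀ᵀ∫|G_k|² ≤ E(v₀) - E(u_k(T)) → 0`
(`leray_euler_tendsto_energyDefect`). This is the precise content of the `blocks:` line of the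
barrier `BrenierDeLellisSzekelyhidi2011_cor1`. [cite: BrueDeLellis2023, §1 and Appendix, Lemma 7] -/
theorem leray_euler_tendsto_cumulativeDissipation (hT : 0 < T)
    (hv₀ : MemLp v₀ 2 volume) (hv₀div : IsWeaklyDivFree v₀)
    (hEuler : IsWeakEulerSolutionOn T 0 v₀ v) (hc : ContinuousInLpOn (Icc 0 T) 2 v)
    (hsymm : ∃ G : ℝ → E → E →L[ℝ] E,
      (∀ᵐ t ∂(volume.restrict (Ioo 0 T)), HasWeakGradient (v t) (G t)) ∧
      ∫⁻ t in Ioo 0 T, eLpNorm (fun x => G t x + adjoint (G t x)) ∞ volume < ∞)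
    (hν : ∀ k, 0 < ν k) (hν₀ : Tendsto ν atTop (𝓝 0))
    (hLeray : ∀ k, IsGlobalLerayHopf (ν k) 0 v₀ (u k)) :
    Tendsto (fun k => ν k * (∫⁻ t in Ioo 0 T, eWeakGradL2Sq (u k t)).toReal) atTop (𝓝 0) := by
  have hdef := leray_euler_tendsto_energyDefect hT hv₀ hv₀div hEuler hc hsymm hν hν₀ hLeray
  have hTI : T ∈ Icc 0 T := ⟨hT.le, le_rfl⟩
  -- the energy inequality bounds the dissipation by the defect
  have hle : ∀ k, ν k * (∫⁻ t in Ioo 0 T, eWeakGradL2Sq (u k t)).toReal ≤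
      VectorCalculus.kineticEnergy v₀ - VectorCalculus.kineticEnergy (u k T) := fun k => by
    obtain ⟨G, hGw, hfin, h0, -⟩ := (hLeray k T hT).weakGrad_energy
    have hE := h0 T hTI
    simp only [Pi.zero_apply, inner_zero_left, integral_zero, intervalIntegral.integral_zero,
      add_zero] at hE
    have hmono : ∫⁻ t in Ioo 0 T, eWeakGradL2Sq (u k t) ≤
        ∫⁻ t in Ioo 0 T, ∫⁻ x, ENNReal.ofReal (frobeniusNormSq (G t x)) := by
      refine lintegral_mono_ae ?_
      filter_upwards [hGw] with t ht
      unfold eWeakGradL2Sq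
      exact iInf₂_le (G t) ht
    have hreal : (∫⁻ t in Ioo 0 T, eWeakGradL2Sq (u k t)).toReal ≤
        (∫⁻ t in Ioo 0 T, ∫⁻ x, ENNReal.ofReal (frobeniusNormSq (G t x))).toReal :=
      ENNReal.toReal_mono hfin.ne hmono
    have := mul_le_mul_of_nonneg_left hreal (hν k).le
    linarith
  have hnn : ∀ k, 0 ≤ ν k * (∫⁻ t in Ioo 0 T, eWeakGradL2Sq (u k t)).toReal := fun k =>
    mul_nonneg (hν k).le ENNReal.toReal_nonneg
  exact tendsto_of_tendsto_of_tendsto_of_le_of_le tendsto_const_nhds hdef hnn hle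

end Literature.Barriers.AnomalousDissipation

end
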